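import Literature.NumberTheory.GaloisCohomology.ShaRestrictedLayerTransport
import Literature.NumberTheory.GaloisRepresentations.CoinducedDiscreteGaloisModule
import HarnessLib

/-!
# `Шⁿ_S(K, Ind_{Γ_L}^{Γ_K} M) ≃+ Шⁿ_S(L, M)` on `G_{L,S} ≤ G_{K,S}` (`n = 1, 2`): the Ш-condition transport under
# restricted Shapiro (Milne I §4; Harari §17.3; NSW (1.6.4)–(1.6.5); Serre VII §5)

Topic `NumberTheory/GaloisCohomology`; namespace `Literature.NumberTheory.GaloisCohomology.ShaLayer`.  Definitions
with bodies (the restricted Shapiro isomorphism with the instances supplied, the two transport equivalences) and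
theorems; NO named fact, no `sorry`, no instance, no notation.  File 4 (head) of the (M7) «Ш-condition transport
under restricted Shapiro» series; sequel of `ShaRestrictedLayerTransport` (the layer groups `layerShaRestricted`, the
transport `restrictedCohomologyEquiv` and the localisation correspondence) and of
`GaloisRepresentations/ContinuousShapiroOpenCoinducedMackeyVanishing` (the semi-local vanishing criterion
`map_restrict_eq_zero_iff_forall_conjMap_one/_two`).  Notation as in `ShaRestrictedLayerTransport`.

Statement (Milne, *ADT* I §4: `Шⁱ_S(K, M) = Ker(Hⁱ(G_S, M) → Π_{v ∈ S} Hⁱ(K_v, M))`; for a finite `L ⊂ K_S` and the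
induced module `Ind_{G_{L,S}}^{G_{K,S}} M`, Shapiro's lemma `Hⁱ(G_{K,S}, Ind M) = Hⁱ(G_{L,S}, M)` (NSW (1.6.4)) together
with its semi-local form `Hⁱ(K_v, Ind M) = ⊕_{w ∣ v} Hⁱ(L_w, M)` (NSW (1.5.6)–(1.5.7), Brown III (5.6)(b)) identifies
`Шⁱ_S(K, Ind M)` with `Шⁱ_S(L, M)` — the standard step by which Poitou–Tate duality "may be applied over `L`",
Milne I §4 / proof of Thm. 5.1 "replace `K` by a larger field").  Here, for `i = 1, 2`:

* §3 `layerShapiroEquiv` (`sh_S : Hⁿ(G_S, Maps(G_S ⧸ N̄, M^{N_S})) ≃+ Hⁿ(N̄, M^{N_S})`, the tree's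
  `shapiroCoindFinAddEquiv` at `G = G_S`); **`restrictedLocalization_eq_zero_iff_layer_one/_two`** (`loc_v c = 0 ↔
  ∀ σ̄ : G_S, layerLocalization v (layerConj σ̄ (sh_S (T c))) = 0`); **`mem_shaRestricted_coindOpen_iff_one/_two`**
  (`c ∈ shaRestricted (ρ.coindOpen N hN) S n ↔ sh_S (T c) ∈ layerShaRestricted S ρ N n`);
  `map_shaRestricted_coindOpen_one/_two`; and the TRANSPORT EQUIVALENCES
  **`shaRestrictedLayerEquiv_one/_two : shaRestricted (ρ.coindOpen N hN) S n ≃+ layerShaRestricted S ρ N n`**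
  (`coe_…` value lemmas) — hypotheses: `N ⊴ Γ_K` open (`[N.FiniteIndex]` for the discreteness instance of
  `Maps(Γ_K ⧸ N, M)`), `N_S ≤ N`, `N_S ≤ ker ρ`.
* §5 the printed Poitou–Tate hypotheses for the induced module: `ramificationSubgroup_le_ker_coindOpen`,
  `isUnramifiedOutside_coindOpen` ("`M` a `G_S`-module"), `mem_of_card_coindOpen_mem` ("order a unit outside `S`").
* §6 bridge to the tree's `DiscreteGaloisModule.coind` (`coindOpen_eq_coind : ρ.coindOpen N hN = ρ.coind N hN`, `rfl`),
  the currency of `PoitouTateShaRestrictedLayers` (`[Fintype (Γ_K ⧸ N)]`): `shaRestrictedCoindLayerEquiv_one/_two`,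
  `coe_…`, `mem_shaRestricted_coind_iff_one/_two`.
* §4 the `Γ_K`-level twin without `S`: **`localization_coindOpen_eq_zero_iff_one/_two`** — for
  `c ∈ Hⁿ(K, Maps(Γ_K ⧸ N, M))` (`galoisCohomology (ρ.coindOpen N hN) n`), `loc_v c = 0 ↔ ∀ σ : Γ_K,
  Hⁿ(φ_v|; id) (σ · sh c) = 0` on `Hⁿ(N, M) = continuousCohomology n (subgroupRep ρ.toTopRep N)` — the currency of the
  tree's `GreenbergSelmer` / `conjMap` files.

Written by the width seat `bsd-line-cf2c-w3` g9 of cell `bsd-print-cf2` (idle-width item (M7), planner ruling (N-PT)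
2026-08-29).  Consumer: with `poitouTate_shaRestricted_tateDual_natural_at K S` applied to `ρ.coindOpen N hN` these
equivalences put Poitou–Tate duality on the layers `K̃_n ⊂ K_S` of a `ℤ_p²`-tower (ROW 1 of the JLK descent, cell
`bsd-print-cf2`, deciding child `MainConjClauseAtSplitTwoQuadDA`; the duality assembly itself is the other half of
(M7)).  HONEST FRAMING: homological algebra + bookkeeping; no arithmetic duality and no case of BSD is proved here.

## References
* J. S. Milne, *Arithmetic Duality Theorems*, 2nd ed. (2006), Ch. I §4 (pp. 55–57), Thm. 4.10 (a), and I §5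
  (proof of Thm. 5.1). [MilneADT2006]
* D. Harari, *Galois Cohomology and Class Field Theory* (2020), §17.2 (p. 290), §17.3 (p. 294), Thm. 17.13 (b).
  [Harari2020]
* J. Neukirch, A. Schmidt, K. Wingberg, *Cohomology of Number Fields*, 2nd ed. (2008), I §5 (1.5.6)–(1.5.7),
  I §6 (1.6.4)–(1.6.5). [NeukirchSchmidtWingberg2008]
* J.-P. Serre, *Local Fields* (1979), VII §5; *Galois Cohomology* (1997), I §2.5 Prop. 10. [SerreLocalFields1979]
  [SerreGaloisCohomology1997]
-/

noncomputable section

open CategoryTheory Function NumberField Field IsDedekindDomain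
open scoped NumberField Classical

namespace Literature.NumberTheory.GaloisCohomology

open Literature.NumberTheory.GaloisRepresentations
open Literature.NumberTheory.GaloisRepresentations.DiscreteGaloisModule (restrictedCohomology
  restrictedLocalization shaRestricted quotientInvariants)
open _root_.TopRep

namespace ShaLayer

variable {K : Type} [Field K] [NumberField K] (S : Set (HeightOneSpectrum (𝓞 K)))
variable {M : Type} [AddCommGroup M] [TopologicalSpace M] [DiscreteTopology M] (ρ : DiscreteGaloisModule K M)
variable (N : Subgroup (absoluteGaloisGroup K)) [N.Normal] (hN : IsOpen (N : Set (absoluteGaloisGroup K)))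

/-! ## §3 The restricted Shapiro isomorphism carries `Шⁿ_S(K, Ind)` onto `Шⁿ_S` of the layer (`n = 1, 2`) -/

/-- **The restricted Shapiro isomorphism `sh_S : Hⁿ(G_S, Maps(G_S ⧸ N̄, M^{N_S})) ≃+ Hⁿ(N̄, M^{N_S})`** (`N̄ = G_{L,S}`):
the tree's `shapiroCoindFinAddEquiv` for the profinite group `G_S` (total disconnectedness supplied here) and
its open subgroup `N̄`. [cite: SerreGaloisCohomology1997, I §2.5 Prop. 10] [cite: NeukirchSchmidtWingberg2008, I §6 Prop. (1.6.4)] -/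
def layerShapiroEquiv (n : ℕ) :
    (continuousCohomology n (coindFin.{0, 0} (ρ.quotientInvariants (ramificationSubgroup K S)).toTopRep
        (N.map (toUnramifiedQuot K S))) : Type) ≃+
      (continuousCohomology n (subgroupRep (ρ.quotientInvariants (ramificationSubgroup K S)).toTopRep
        (N.map (toUnramifiedQuot K S))) : Type) :=
  haveI : TotallyDisconnectedSpace (GaloisGroupUnramifiedOutside K S) :=
    Literature.GroupTheory.ProfiniteSubquotients.totallyDisconnectedSpace_quotient
      (ramificationSubgroup K S) (ramificationSubgroup_isClosed K S)
  (ρ.quotientInvariants (ramificationSubgroup K S)).shapiroCoindFinAddEquiv (N.map (toUnramifiedQuot K S))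
    (isOpen_map_toUnramifiedQuot S N hN) n

section Main

variable [N.FiniteIndex] (hNS : ramificationSubgroup K S ≤ N) (hρ : ramificationSubgroup K S ≤ ContinuousRep.ker ρ)

/-- **The local conditions correspond, degree `1`**: `loc_v c = 0` for `c ∈ H¹(G_S, (Ind_N^{Γ_K} M)^{N_S})` iff the
layer class `sh_S (T c) ∈ H¹(N̄, M^{N_S})` is killed by `layerLocalization v ∘ layerConj σ̄` for EVERY `σ̄ ∈ G_S`
(the semi-local vanishing criterion `map_restrict_eq_zero_iff_forall_conjMap_one` at `G = G_S`, `D = Γ_{K_v}`,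
`θ = φ_v`). [cite: NeukirchSchmidtWingberg2008, I §5 (1.5.6)–(1.5.7), I §6 (1.6.4)–(1.6.5)] [cite: MilneADT2006, Ch. I §4 (p. 56)] -/
theorem restrictedLocalization_eq_zero_iff_layer_one (v : Place K) (c : restrictedCohomology (ρ.coindOpen N hN) S 1) :
    restrictedLocalization (ρ.coindOpen N hN) S v 1 c = 0 ↔
      ∀ σ : GaloisGroupUnramifiedOutside K S,
        layerLocalization S ρ N v 1 (layerConj S ρ N σ 1
          (layerShapiroEquiv S ρ N hN 1 (restrictedCohomologyEquiv S ρ N hN hNS hρ 1 c))) = 0 := by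
  rw [restrictedLocalization_eq_zero_iff]
  haveI : TotallyDisconnectedSpace (GaloisGroupUnramifiedOutside K S) :=
    Literature.GroupTheory.ProfiniteSubquotients.totallyDisconnectedSpace_quotient
      (ramificationSubgroup K S) (ramificationSubgroup_isClosed K S)
  haveI : CompactSpace (absoluteGaloisGroup (Place.Completion v)) := absoluteGaloisGroup_compactSpace _
  exact map_restrict_eq_zero_iff_forall_conjMap_one (ρ.quotientInvariants (ramificationSubgroup K S))
    (N.map (toUnramifiedQuot K S)) (isOpen_map_toUnramifiedQuot S N hN) (RestrictedExt.localizationHom K S v) _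

/-- **The local conditions correspond, degree `2`** (as `…_one`). [cite: NeukirchSchmidtWingberg2008, I §5 (1.5.6)–(1.5.7), I §6 (1.6.4)–(1.6.5)] [cite: MilneADT2006, Ch. I §4 (p. 56)] -/
theorem restrictedLocalization_eq_zero_iff_layer_two (v : Place K) (c : restrictedCohomology (ρ.coindOpen N hN) S 2) :
    restrictedLocalization (ρ.coindOpen N hN) S v 2 c = 0 ↔
      ∀ σ : GaloisGroupUnramifiedOutside K S,
        layerLocalization S ρ N v 2 (layerConj S ρ N σ 2
          (layerShapiroEquiv S ρ N hN 2 (restrictedCohomologyEquiv S ρ N hN hNS hρ 2 c))) = 0 := by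
  rw [restrictedLocalization_eq_zero_iff]
  haveI : TotallyDisconnectedSpace (GaloisGroupUnramifiedOutside K S) :=
    Literature.GroupTheory.ProfiniteSubquotients.totallyDisconnectedSpace_quotient
      (ramificationSubgroup K S) (ramificationSubgroup_isClosed K S)
  haveI : CompactSpace (absoluteGaloisGroup (Place.Completion v)) := absoluteGaloisGroup_compactSpace _
  exact map_restrict_eq_zero_iff_forall_conjMap_two (ρ.quotientInvariants (ramificationSubgroup K S))
    (N.map (toUnramifiedQuot K S)) (isOpen_map_toUnramifiedQuot S N hN) (RestrictedExt.localizationHom K S v) _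

/-- **`Ш¹_S(K, Ind_N^{Γ_K} M)` corresponds to `Ш¹_S` of the layer**: a class `c ∈ H¹(G_S, (Maps(Γ_K⧸N, M))^{N_S})` lies in
the tree's `shaRestricted (ρ.coindOpen N hN) S 1` iff its restricted Shapiro image lies in `layerShaRestricted S ρ N 1`
— "a class of `Ind_L^K M` is locally trivial at the places of `S ∪ Ω_∞` iff the corresponding class over `L` is
locally trivial at every place of `L` above `S ∪ Ω_∞`" (Milne I §4 / Harari §17.3 `Ш¹_S`, with NSW (1.6.4)–(1.6.5)).
[cite: MilneADT2006, Ch. I §4 (p. 56)] [cite: Harari2020, §17.3 (p. 294)] [cite: NeukirchSchmidtWingberg2008, I §6 (1.6.4)–(1.6.5)] -/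
theorem mem_shaRestricted_coindOpen_iff_one (c : restrictedCohomology (ρ.coindOpen N hN) S 1) :
    c ∈ shaRestricted (ρ.coindOpen N hN) S 1 ↔
      layerShapiroEquiv S ρ N hN 1 (restrictedCohomologyEquiv S ρ N hN hNS hρ 1 c) ∈ layerShaRestricted S ρ N 1 := by
  rw [DiscreteGaloisModule.mem_shaRestricted_iff, mem_layerShaRestricted_iff]
  simp only [restrictedLocalization_eq_zero_iff_layer_one S ρ N hN hNS hρ]

/-- **`Ш²_S(K, Ind_N^{Γ_K} M)` corresponds to `Ш²_S` of the layer** (as `…_one`, degree `2`).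
[cite: MilneADT2006, Ch. I §4 (p. 56)] [cite: Harari2020, §17.3 (p. 294)] [cite: NeukirchSchmidtWingberg2008, I §6 (1.6.4)–(1.6.5)] -/
theorem mem_shaRestricted_coindOpen_iff_two (c : restrictedCohomology (ρ.coindOpen N hN) S 2) :
    c ∈ shaRestricted (ρ.coindOpen N hN) S 2 ↔
      layerShapiroEquiv S ρ N hN 2 (restrictedCohomologyEquiv S ρ N hN hNS hρ 2 c) ∈ layerShaRestricted S ρ N 2 := by
  rw [DiscreteGaloisModule.mem_shaRestricted_iff, mem_layerShaRestricted_iff]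
  simp only [restrictedLocalization_eq_zero_iff_layer_two S ρ N hN hNS hρ]

/-- The image of `Ш¹_S(K, Ind)` under the composite isomorphism is `Ш¹_S` of the layer. [cite: MilneADT2006, Ch. I §4 (p. 56)] -/
theorem map_shaRestricted_coindOpen_one :
    (shaRestricted (ρ.coindOpen N hN) S 1).map
        (((restrictedCohomologyEquiv S ρ N hN hNS hρ 1).trans (layerShapiroEquiv S ρ N hN 1) :
          restrictedCohomology (ρ.coindOpen N hN) S 1 ≃+ _) : restrictedCohomology (ρ.coindOpen N hN) S 1 →+ _) =
      layerShaRestricted S ρ N 1 := by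
  ext z
  constructor
  · rintro ⟨c, hc, rfl⟩
    exact (mem_shaRestricted_coindOpen_iff_one S ρ N hN hNS hρ c).1 hc
  · intro hz
    refine ⟨((restrictedCohomologyEquiv S ρ N hN hNS hρ 1).trans (layerShapiroEquiv S ρ N hN 1)).symm z, ?_,
      AddEquiv.apply_symm_apply _ z⟩
    refine (mem_shaRestricted_coindOpen_iff_one S ρ N hN hNS hρ _).2 ?_
    rw [AddEquiv.symm_trans_apply, AddEquiv.apply_symm_apply, AddEquiv.apply_symm_apply]
    exact hz

/-- The image of `Ш²_S(K, Ind)` under the composite isomorphism is `Ш²_S` of the layer. [cite: MilneADT2006, Ch. I §4 (p. 56)] -/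
theorem map_shaRestricted_coindOpen_two :
    (shaRestricted (ρ.coindOpen N hN) S 2).map
        (((restrictedCohomologyEquiv S ρ N hN hNS hρ 2).trans (layerShapiroEquiv S ρ N hN 2) :
          restrictedCohomology (ρ.coindOpen N hN) S 2 ≃+ _) : restrictedCohomology (ρ.coindOpen N hN) S 2 →+ _) =
      layerShaRestricted S ρ N 2 := by
  ext z
  constructor
  · rintro ⟨c, hc, rfl⟩
    exact (mem_shaRestricted_coindOpen_iff_two S ρ N hN hNS hρ c).1 hc
  · intro hz
    refine ⟨((restrictedCohomologyEquiv S ρ N hN hNS hρ 2).trans (layerShapiroEquiv S ρ N hN 2)).symm z, ?_,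
      AddEquiv.apply_symm_apply _ z⟩
    refine (mem_shaRestricted_coindOpen_iff_two S ρ N hN hNS hρ _).2 ?_
    rw [AddEquiv.symm_trans_apply, AddEquiv.apply_symm_apply, AddEquiv.apply_symm_apply]
    exact hz

/-- **THE Ш-CONDITION TRANSPORT, degree `1`: `Ш¹_S(K, Ind_N^{Γ_K} M) ≃+ Ш¹_S(L, M)`** — the tree's
`shaRestricted (ρ.coindOpen N hN) S 1 ≤ H¹(G_S, (Maps(Γ_K ⧸ N, M))^{N_S})` is carried by (transport along
`Maps(Γ_K⧸N, M)^{N_S} ≅ Maps(G_S⧸N̄, M^{N_S})`, then) the restricted Shapiro isomorphism onto `layerShaRestricted S ρ N 1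
≤ H¹(N̄, M^{N_S})`, the classes of the layer `G_{L,S} = N̄` locally trivial at every place of `L` above `S ∪ Ω_∞`.
Hypotheses: `N ⊴ Γ_K` open with `N_S ≤ N` (`L ⊂ K_S`), `M` unramified outside `S` (`N_S ≤ ker ρ`).  With the tree's
named fact `poitouTate_shaRestricted_tateDual_natural_at K S` applied to `Ind_N^{Γ_K} M` this is the Shapiro step
that puts Poitou–Tate duality ON THE LAYERS of a tower inside `K_S` (Milne I §4; the consumer is ROW 1 of the JLK
descent of cell `bsd-print-cf2`).  HONEST FRAMING: homological algebra + bookkeeping; no arithmetic duality is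
proved here. [cite: MilneADT2006, Ch. I §4, Thm. 4.10 (a) (pp. 56–57)] [cite: Harari2020, Thm. 17.13 (b) (p. 294)]
[cite: NeukirchSchmidtWingberg2008, I §6 (1.6.4)–(1.6.5)] -/
def shaRestrictedLayerEquiv_one : shaRestricted (ρ.coindOpen N hN) S 1 ≃+ layerShaRestricted S ρ N 1 :=
  (((restrictedCohomologyEquiv S ρ N hN hNS hρ 1).trans (layerShapiroEquiv S ρ N hN 1)).addSubgroupMap
      (shaRestricted (ρ.coindOpen N hN) S 1)).trans
    (AddEquiv.addSubgroupCongr (map_shaRestricted_coindOpen_one S ρ N hN hNS hρ))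

/-- **THE Ш-CONDITION TRANSPORT, degree `2`: `Ш²_S(K, Ind_N^{Γ_K} M) ≃+ Ш²_S(L, M)`** (as `…_one`).
[cite: MilneADT2006, Ch. I §4, Thm. 4.10 (a) (pp. 56–57)] [cite: Harari2020, Thm. 17.13 (b) (p. 294)]
[cite: NeukirchSchmidtWingberg2008, I §6 (1.6.4)–(1.6.5)] -/
def shaRestrictedLayerEquiv_two : shaRestricted (ρ.coindOpen N hN) S 2 ≃+ layerShaRestricted S ρ N 2 :=
  (((restrictedCohomologyEquiv S ρ N hN hNS hρ 2).trans (layerShapiroEquiv S ρ N hN 2)).addSubgroupMap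
      (shaRestricted (ρ.coindOpen N hN) S 2)).trans
    (AddEquiv.addSubgroupCongr (map_shaRestricted_coindOpen_two S ρ N hN hNS hρ))

/-- Value of `shaRestrictedLayerEquiv_one`: the underlying class is `sh_S (T c)`. [cite: MilneADT2006, Ch. I §4 (p. 56)] -/
@[simp]
theorem coe_shaRestrictedLayerEquiv_one (c : shaRestricted (ρ.coindOpen N hN) S 1) :
    (shaRestrictedLayerEquiv_one S ρ N hN hNS hρ c : continuousCohomology 1
        (subgroupRep (ρ.quotientInvariants (ramificationSubgroup K S)).toTopRep (N.map (toUnramifiedQuot K S)))) =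
      layerShapiroEquiv S ρ N hN 1 (restrictedCohomologyEquiv S ρ N hN hNS hρ 1 c) := rfl

/-- Value of `shaRestrictedLayerEquiv_two`. [cite: MilneADT2006, Ch. I §4 (p. 56)] -/
@[simp]
theorem coe_shaRestrictedLayerEquiv_two (c : shaRestricted (ρ.coindOpen N hN) S 2) :
    (shaRestrictedLayerEquiv_two S ρ N hN hNS hρ c : continuousCohomology 2
        (subgroupRep (ρ.quotientInvariants (ramificationSubgroup K S)).toTopRep (N.map (toUnramifiedQuot K S)))) =
      layerShapiroEquiv S ρ N hN 2 (restrictedCohomologyEquiv S ρ N hN hNS hρ 2 c) := rfl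

end Main

/-! ## §4 The `Γ_K`-level twin (no `S`): localisation of `Hⁿ(K, Maps(Γ_K ⧸ N, M))` read on `Hⁿ(N, M)` -/

section AbsoluteLevel

variable [N.FiniteIndex]

/-- **`loc_v c = 0 ↔ ∀ σ, (σ · sh c)|_{Γ_{L_w}} = 0` on `H¹`**: for `c ∈ H¹(K, Maps(Γ_K ⧸ N, M))` (the tree's
`galoisCohomology (ρ.coindOpen N hN) 1`), the localisation at a place `v` of `K` vanishes iff for every `σ ∈ Γ_K` the
conjugate of the Shapiro image `sh c ∈ H¹(N, M)` restricts to zero along `φ_v⁻¹N → N`, `φ_v : Γ_{K_v} → Γ_K`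
(= at every place of `L = K̄^N` above `v`; the shape of the tree's Greenberg–Vatsal local conditions
`⨅ σ, comap (conjH1 σ) (…)`). [cite: NeukirchSchmidtWingberg2008, I §5 (1.5.6)–(1.5.7), I §6 (1.6.4)–(1.6.5)] [cite: MilneADT2006, Ch. I §4 (p. 55)] -/
theorem localization_coindOpen_eq_zero_iff_one (v : Place K) (c : galoisCohomology (ρ.coindOpen N hN) 1) :
    galoisCohomology.localization (ρ.coindOpen N hN) v 1 c = 0 ↔
      ∀ σ : absoluteGaloisGroup K,
        (ContinuousCohomology.map (comapSubtypeHom N (absGaloisRestrict K (Place.Completion v)))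
          (comapCoeffHom ρ.toTopRep N (absGaloisRestrict K (Place.Completion v))) 1).hom
          (conjMap ρ.toTopRep N σ 1 (ρ.shapiroCoindFinAddEquiv N hN 1 c)) = 0 := by
  haveI : CompactSpace (absoluteGaloisGroup (Place.Completion v)) := absoluteGaloisGroup_compactSpace _
  have hloc : galoisCohomology.localization (ρ.coindOpen N hN) v 1 c =
      (ContinuousCohomology.map (absGaloisRestrict K (Place.Completion v))
        (𝟙 (TopRep.res (absGaloisRestrict K (Place.Completion v) :
            absoluteGaloisGroup (Place.Completion v) →* absoluteGaloisGroup K) (coindFin.{0, 0} ρ.toTopRep N))) 1).hom c :=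
    congrArg (fun T => TopModuleCat.Hom.hom T c) (continuousCohomology_map_congr rfl _ _ (fun _ => rfl) 1)
  rw [hloc]
  exact map_restrict_eq_zero_iff_forall_conjMap_one ρ N hN (absGaloisRestrict K (Place.Completion v)) c

/-- **`loc_v c = 0 ↔ ∀ σ, (σ · sh c)|_{Γ_{L_w}} = 0` on `H²`** (as `…_one`). [cite: NeukirchSchmidtWingberg2008, I §5 (1.5.6)–(1.5.7), I §6 (1.6.4)–(1.6.5)] [cite: MilneADT2006, Ch. I §4 (p. 55)] -/
theorem localization_coindOpen_eq_zero_iff_two (v : Place K) (c : galoisCohomology (ρ.coindOpen N hN) 2) :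
    galoisCohomology.localization (ρ.coindOpen N hN) v 2 c = 0 ↔
      ∀ σ : absoluteGaloisGroup K,
        (ContinuousCohomology.map (comapSubtypeHom N (absGaloisRestrict K (Place.Completion v)))
          (comapCoeffHom ρ.toTopRep N (absGaloisRestrict K (Place.Completion v))) 2).hom
          (conjMap ρ.toTopRep N σ 2 (ρ.shapiroCoindFinAddEquiv N hN 2 c)) = 0 := by
  haveI : CompactSpace (absoluteGaloisGroup (Place.Completion v)) := absoluteGaloisGroup_compactSpace _
  have hloc : galoisCohomology.localization (ρ.coindOpen N hN) v 2 c =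
      (ContinuousCohomology.map (absGaloisRestrict K (Place.Completion v))
        (𝟙 (TopRep.res (absGaloisRestrict K (Place.Completion v) :
            absoluteGaloisGroup (Place.Completion v) →* absoluteGaloisGroup K) (coindFin.{0, 0} ρ.toTopRep N))) 2).hom c :=
    congrArg (fun T => TopModuleCat.Hom.hom T c) (continuousCohomology_map_congr rfl _ _ (fun _ => rfl) 2)
  rw [hloc]
  exact map_restrict_eq_zero_iff_forall_conjMap_two ρ N hN (absGaloisRestrict K (Place.Completion v)) c

end AbsoluteLevel

/-! ## §5 The printed hypotheses of Poitou–Tate for the induced module -/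

section Hypotheses

variable (hNS : ramificationSubgroup K S ≤ N) (hρ : ramificationSubgroup K S ≤ ContinuousRep.ker ρ)

include hNS hρ in
/-- **`Ind_N^{Γ_K} M` is a `G_S`-module**: `N_S` acts trivially on `Maps(Γ_K ⧸ N, M)` when `N_S ≤ N` and `N_S` acts
trivially on `M` (`(n ⋆ φ)(y) = n • φ(n⁻¹ y) = φ(y)`). [cite: Harari2020, Def. 15.36 and Remark 17.7 (b)]
[cite: MilneADT2006, Ch. I §4 (p. 47, `G_S`-modules)] -/
theorem ramificationSubgroup_le_ker_coindOpen :
    ramificationSubgroup K S ≤ ContinuousRep.ker (ρ.coindOpen N hN) := by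
  intro g hg
  rw [ContinuousRep.mem_ker]
  have hρg : ρ g = LinearMap.id := (ContinuousRep.mem_ker ρ g).1 (hρ hg)
  refine LinearMap.ext fun φ => funext fun y => ?_
  obtain ⟨x, rfl⟩ := QuotientGroup.mk_surjective y
  rw [LinearMap.id_apply, ContinuousRep.coindOpen_apply_apply, hρg, LinearMap.id_apply, MulAction.Quotient.smul_mk,
    smul_eq_mul]
  exact congrArg φ (QuotientGroup.eq.2 (‹N.Normal›.conj_mem' g (hNS hg) x))

include hNS hρ in
/-- **`Ind_N^{Γ_K} M` is unramified outside `S`** (the printed hypothesis "`M` a `G_S`-module" of Milne I 4.10 /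
Harari 17.13 for the induced module, in the tree's `GaloisRep.IsUnramifiedOutside` currency).
[cite: MilneADT2006, Ch. I §4, Thm. 4.10 (a)] [cite: Harari2020, Thm. 17.13 (b) and Remark 17.7 (b)] -/
theorem isUnramifiedOutside_coindOpen [N.FiniteIndex] : GaloisRep.IsUnramifiedOutside S (ρ.coindOpen N hN) :=
  (DiscreteGaloisModule.isUnramifiedOutside_iff_ramificationSubgroup_le_ker (ρ.coindOpen N hN) S).2
    (ramificationSubgroup_le_ker_coindOpen S ρ N hN hNS hρ)

omit [AddCommGroup M] [TopologicalSpace M] [DiscreteTopology M] [N.Normal] in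
include hN in
/-- **"Order a unit outside `S`" for the induced module**: `#Maps(Γ_K ⧸ N, M) = #M ^ [Γ_K : N]`, so every finite place
dividing `#Maps(Γ_K ⧸ N, M)` divides `#M` (primality of `v`); hence the printed hypothesis of Milne I 4.10 / Harari
17.13 passes from `M` to `Ind_N^{Γ_K} M`. [cite: MilneADT2006, Ch. I §4, Thm. 4.10 (a)] [cite: Harari2020, Thm. 17.13 (b)] -/
theorem mem_of_card_coindOpen_mem
    (hS : ∀ v : HeightOneSpectrum (𝓞 K), ((Nat.card M : ℕ) : 𝓞 K) ∈ v.asIdeal → v ∈ S)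
    (v : HeightOneSpectrum (𝓞 K)) (hv : ((Nat.card (absoluteGaloisGroup K ⧸ N → M) : ℕ) : 𝓞 K) ∈ v.asIdeal) :
    v ∈ S := by
  rw [ContinuousRep.natCard_coindOpen (G := absoluteGaloisGroup K) (M := M) N hN, Nat.cast_pow] at hv
  exact hS v (v.isPrime.mem_of_pow_mem _ hv)

end Hypotheses

/-! ## §6 Bridge to the tree's `DiscreteGaloisModule.coind` (same module; `[Fintype (Γ_K ⧸ N)]` currency) -/

section Coind

variable [Fintype (absoluteGaloisGroup K ⧸ N)] (hNS : ramificationSubgroup K S ≤ N)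
  (hρ : ramificationSubgroup K S ≤ ContinuousRep.ker ρ)

omit [N.Normal] in
/-- **`ρ.coindOpen N hN = ρ.coind N hN`** (the permutation model of `ContinuousShapiroOpenCoinduced` and the coinduced
discrete Galois module of `CoinducedDiscreteGaloisModule` are the same `DiscreteGaloisModule`, definitionally; the
arithmetic-duality file `PoitouTateShaRestrictedLayers` speaks of the latter). [cite: SerreLocalFields1979, VII §5–§6] -/
theorem coindOpen_eq_coind : ρ.coindOpen N hN = ρ.coind N hN := rfl

/-- **`Ш¹_S(K, ρ.coind N hN) ≃+ Ш¹_S` of the layer**, in the `coind` currency of `PoitouTateShaRestrictedLayers`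
(`= shaRestrictedLayerEquiv_one` through `coindOpen_eq_coind`). [cite: MilneADT2006, Ch. I §4, Thm. 4.10 (a)]
[cite: NeukirchSchmidtWingberg2008, I §6 (1.6.4)–(1.6.5)] -/
def shaRestrictedCoindLayerEquiv_one : shaRestricted (ρ.coind N hN) S 1 ≃+ layerShaRestricted S ρ N 1 :=
  haveI : N.FiniteIndex := finiteIndex_of_isOpen' N hN
  shaRestrictedLayerEquiv_one S ρ N hN hNS hρ

/-- **`Ш²_S(K, ρ.coind N hN) ≃+ Ш²_S` of the layer**, in the `coind` currency (`= shaRestrictedLayerEquiv_two`).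
[cite: MilneADT2006, Ch. I §4, Thm. 4.10 (a)] [cite: NeukirchSchmidtWingberg2008, I §6 (1.6.4)–(1.6.5)] -/
def shaRestrictedCoindLayerEquiv_two : shaRestricted (ρ.coind N hN) S 2 ≃+ layerShaRestricted S ρ N 2 :=
  haveI : N.FiniteIndex := finiteIndex_of_isOpen' N hN
  shaRestrictedLayerEquiv_two S ρ N hN hNS hρ

/-- Value of `shaRestrictedCoindLayerEquiv_one`: the restricted Shapiro image of the transported class
(`restrictedCohomology (ρ.coind N hN) S 1 = restrictedCohomology (ρ.coindOpen N hN) S 1` definitionally).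
[cite: MilneADT2006, Ch. I §4 (p. 56)] -/
theorem coe_shaRestrictedCoindLayerEquiv_one (c : shaRestricted (ρ.coind N hN) S 1) :
    haveI : N.FiniteIndex := finiteIndex_of_isOpen' N hN
    (shaRestrictedCoindLayerEquiv_one S ρ N hN hNS hρ c : continuousCohomology 1
        (subgroupRep (ρ.quotientInvariants (ramificationSubgroup K S)).toTopRep (N.map (toUnramifiedQuot K S)))) =
      layerShapiroEquiv S ρ N hN 1 (restrictedCohomologyEquiv S ρ N hN hNS hρ 1
        ((c : restrictedCohomology (ρ.coind N hN) S 1) : restrictedCohomology (ρ.coindOpen N hN) S 1)) := rfl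

/-- Value of `shaRestrictedCoindLayerEquiv_two`. [cite: MilneADT2006, Ch. I §4 (p. 56)] -/
theorem coe_shaRestrictedCoindLayerEquiv_two (c : shaRestricted (ρ.coind N hN) S 2) :
    haveI : N.FiniteIndex := finiteIndex_of_isOpen' N hN
    (shaRestrictedCoindLayerEquiv_two S ρ N hN hNS hρ c : continuousCohomology 2
        (subgroupRep (ρ.quotientInvariants (ramificationSubgroup K S)).toTopRep (N.map (toUnramifiedQuot K S)))) =
      layerShapiroEquiv S ρ N hN 2 (restrictedCohomologyEquiv S ρ N hN hNS hρ 2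
        ((c : restrictedCohomology (ρ.coind N hN) S 2) : restrictedCohomology (ρ.coindOpen N hN) S 2)) := rfl

/-- Membership form in the `coind` currency, degree `1`. [cite: MilneADT2006, Ch. I §4 (p. 56)] -/
theorem mem_shaRestricted_coind_iff_one (c : restrictedCohomology (ρ.coind N hN) S 1) :
    haveI : N.FiniteIndex := finiteIndex_of_isOpen' N hN
    c ∈ shaRestricted (ρ.coind N hN) S 1 ↔
      layerShapiroEquiv S ρ N hN 1 (restrictedCohomologyEquiv S ρ N hN hNS hρ 1
        (c : restrictedCohomology (ρ.coindOpen N hN) S 1)) ∈ layerShaRestricted S ρ N 1 :=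
  haveI : N.FiniteIndex := finiteIndex_of_isOpen' N hN
  mem_shaRestricted_coindOpen_iff_one S ρ N hN hNS hρ c

/-- Membership form in the `coind` currency, degree `2`. [cite: MilneADT2006, Ch. I §4 (p. 56)] -/
theorem mem_shaRestricted_coind_iff_two (c : restrictedCohomology (ρ.coind N hN) S 2) :
    haveI : N.FiniteIndex := finiteIndex_of_isOpen' N hN
    c ∈ shaRestricted (ρ.coind N hN) S 2 ↔
      layerShapiroEquiv S ρ N hN 2 (restrictedCohomologyEquiv S ρ N hN hNS hρ 2
        (c : restrictedCohomology (ρ.coindOpen N hN) S 2)) ∈ layerShaRestricted S ρ N 2 :=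
  haveI : N.FiniteIndex := finiteIndex_of_isOpen' N hN
  mem_shaRestricted_coindOpen_iff_two S ρ N hN hNS hρ c

end Coind

end ShaLayer

end Literature.NumberTheory.GaloisCohomology

end
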